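/-
Copyright (c) 2026 the pub-hodgecm-mathlib formalisation cell (harness21).  Prover seat hodgecm-mathlib-K2Liu-p10 (g2), Track B «K2-LIT»,
#184♮ = hLiu418 = `stmt-HodgeConjecture-24832`; LEAD F0P6-plan (g12) deals 2026-09-04T07:20:45Z (c) ∕ 07:29:53Z (b), SIGS-RoadI-v3 §Hol
row Hol-2b «ADELIC SENTENCE», file 1∕2 (the frame map).  THEOREMS ONLY (no `def`, no `instance`, no named-fact hypothesis, no `sorry`).
-/
import Summits.HodgeConjecture.HodgeConjecture.Theorems.K2LiuHolTubeRigidity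
import Summits.HodgeConjecture.HodgeConjecture.Theorems.K2LiuSiegelUnipotentArchPlaces
import Summits.HodgeConjecture.HodgeConjecture.Theorems.K2LiuWeylDeltaRational
import Literature.NumberTheory.Automorphic.UnitaryGroupAdelicLift
import HarnessLib

/-!
# Crux `HLiu418`, Road I, organ Hol-2b (file 1∕2): RIGIDITY THROUGH A FRAME MAP, and the adelic frame map
# `Fr_w(a) = T_w · (a_w)~ · T_w⁻¹ : H_∞ → ∏_w U(J)` — multiplicative, onto, detects `N_Δ`, carries `w_Δ` to `T·diag(1,−1)·T⁻¹`

Cell `hodgecm-mathlib`, crux item hLiu418 = `stmt-HodgeConjecture-24832` (helper lane, count-neutral).  Sequel of ★ Hol-2b CORE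
`K2LiuHolTubeRigidity` (tube currency), consumed by the adelic sentence `K2LiuHolFourierRigidityOfResidue` (file 2∕2).
* §1 (generic) a group `A`, a map `Fr : A → ∏_σ M_{2n}(ℂ)` multiplicative, valued in and ONTO `∏_σ U(J)`; `F : X → A → ℂ` and its
  tube-side avatar `Φ` (`Φ x (Fr a) = F x a` — the ONE link hypothesis), `f` the holomorphic descent of `Φ` ((E0) = ★ core dictionary
  VERBATIM, (E1)); a symmetry of `F` on `A` becomes (E4) for `Φ` (`tube_symmetry_of_frame`); unipotent invariance of `F` becomes (E2) for `f`
  (`apply_add_eq_of_unip_invariant`, via ★ `descended_cocycle` at a translation); **`eq_zero_of_hol_of_frame`** = ★ core rigidity pulled back.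
* §2 (adelic) `A = H_∞ = UnitaryGroup.arch …`, `σ` = complex places, ONE per-place tube frame `(T_w, T_w⁻¹)` BY VALUE with the clauses of
  ★ `exists_tubeFrame_arch₂∕₃` as hypotheses (U5 `choose`s once), `Fr` BY VALUE with its defining equation `hFr`:
  `frame_mul` (`archAt w` is a hom), `frame_mem` (iii), `frame_surj` ((vi) glued by ★ `archPiEquiv`), **`archToAdelic_mem_unipDelta_of_frame`**
  ((iv′) + frame injectivity + ★ `mem_unipDeltaArch_iff_forall_archAt`: framed to hermitian translations ⇒ `(u,1) ∈ N_Δ(𝔸)`), and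
  **`frame_archPart_weylDelta`**: `Fr_w((w_Δ)_∞) = T_w · diag(1,−1) · T_w⁻¹` (★ `weylDelta_mem_ratH`, ★ `coe_weylDelta_eq_map`, `(γ)_∞ = γ ⊗ 1`).
Sources: [Shimura1997, §§5–6]; [BorelJacquet1979, §4.1]; [GelbartPiatetskishapiroRallis1987, Part A §1].
HONEST LABEL.  Helper lemmas, count-neutral; `HC_CM` is proved only modulo the 7 printed citations (2 remaining named inputs:
hLiu418 = `stmt-HodgeConjecture-24832`, h413 = `stmt-HodgeConjecture-24833`) until rung 0 closes.
-/

set_option autoImplicit false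
set_option linter.dupNamespace false -- the mandated namespace repeats `HodgeConjecture.HodgeConjecture`

noncomputable section

namespace Summit.HodgeConjecture.HodgeConjecture.Cruxes.HLiu418.K2LiuHolTubeRigidityOfFrame

open Matrix Complex Set
open scoped MatrixGroups ComplexOrder BigOperators
open NumberField NumberField.InfinitePlace IsDedekindDomain
open Literature.NumberTheory.ModularForms.SiegelUpperHalfSpace (num denom moeb)
open Literature.AlgebraicGeometry.ShimuraVarieties.KudlaRapoport2013.Sec11Sec12MainTheorem (hermUpperHalfSpace)
open Literature.NumberTheory.Automorphic Literature.NumberTheory.Automorphic.UnitaryGroup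
open Literature.NumberTheory.GelbartRogawski1991 Literature.NumberTheory.GelbartRogawski1991.GRConstruction
open Literature.NumberTheory.K2Lit.SiegelDoubled
open K2LiuHermitianTubeCocycle K2LiuHermitianTubeAction K2LiuHolTubeRigidity K2LiuSiegelUnipotentLocalDefs K2LiuSiegelUnipotentArchPlaces
  K2LiuWeylDeltaRational

/-! ## 1. Generic: rigidity through a frame map `Fr : A → ∏_σ U(J)` -/

section Frame

variable {σ : Type*} [Fintype σ] {n : ℕ} {A : Type*} [Group A] {X : Type*}
  (Fr : A → σ → Matrix (Fin n ⊕ Fin n) (Fin n ⊕ Fin n) ℂ)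
  (hmul : ∀ a b s, Fr (a * b) s = Fr a s * Fr b s)
  (hmem : ∀ a s, (Fr a s)ᴴ * Matrix.J (Fin n) ℂ * Fr a s = Matrix.J (Fin n) ℂ)
  (hsurj : ∀ g : σ → Matrix (Fin n ⊕ Fin n) (Fin n ⊕ Fin n) ℂ, (∀ s, (g s)ᴴ * Matrix.J (Fin n) ℂ * g s = Matrix.J (Fin n) ℂ) →
    ∃ a, Fr a = g)
  (k : σ → ℤ) (F : X → A → ℂ) (Φ : X → (σ → Matrix (Fin n ⊕ Fin n) (Fin n ⊕ Fin n) ℂ) → ℂ) (hΦ : ∀ x a, Φ x (Fr a) = F x a)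
  (f : X → (σ → Matrix (Fin n) (Fin n) ℂ) → ℂ)
  (hE0 : ∀ x g, (∀ s, (g s)ᴴ * Matrix.J (Fin n) ℂ * g s = Matrix.J (Fin n) ℂ) →
    f x (fun s => moeb (g s) (I • 1)) = (∏ s, (denom (g s) (I • 1)).det ^ k s) * Φ x g)
  (hN : ∀ x u a, (∀ s, ∃ b : Matrix (Fin n) (Fin n) ℂ, bᴴ = b ∧ Fr u s = fromBlocks 1 b 0 1) → F x (u * a) = F x a)

omit [Fintype σ] in
include hmul hsurj hΦ in
/-- Through an onto multiplicative frame map, a symmetry `F x (aγ a) = F (τ x) a` of `F` on `A` becomes the twisted invariance (E4)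
`Φ x (γ g) = Φ (τ x) g` of the tube-side `Φ` on `∏_σ U(J)`, `γ = Fr aγ`. [cite: Shimura1997, §5] -/
theorem tube_symmetry_of_frame {aγ : A} {τ : X → X} (hγ : ∀ x a, F x (aγ * a) = F (τ x) a) (x : X)
    (g : σ → Matrix (Fin n ⊕ Fin n) (Fin n ⊕ Fin n) ℂ) (hg : ∀ s, (g s)ᴴ * Matrix.J (Fin n) ℂ * g s = Matrix.J (Fin n) ℂ) :
    Φ x (fun s => Fr aγ s * g s) = Φ (τ x) g := by
  obtain ⟨a, rfl⟩ := hsurj g hg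
  have h : (fun s => Fr aγ s * Fr a s) = Fr (aγ * a) := funext fun s => (hmul aγ a s).symm
  rw [h, hΦ, hΦ, hγ]

include hmul hsurj hΦ hE0 hN in
/-- **(E2), tube form, from unipotent invariance**: if `F x` is invariant under every `u ∈ A` framed to a hermitian translation, the
descended `f x` is invariant under all placewise-hermitian translations on `ℌ_n^σ` (transitivity ★ `exists_siegel_moeb_I_eq`, cocycle
★ `descended_cocycle`, `denom (1 b; 0 1) = 1`). [cite: Shimura1997, §§5–6] -/
theorem apply_add_eq_of_unip_invariant (x : X) (Z b : σ → Matrix (Fin n) (Fin n) ℂ) (hZ : ∀ s, Z s ∈ hermUpperHalfSpace n)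
    (hb : ∀ s, (b s)ᴴ = b s) : f x (Z + b) = f x Z := by
  have htU : ∀ s, (fromBlocks 1 (b s) 0 1 : Matrix (Fin n ⊕ Fin n) (Fin n ⊕ Fin n) ℂ)ᴴ * Matrix.J (Fin n) ℂ * fromBlocks 1 (b s) 0 1 =
      Matrix.J (Fin n) ℂ := fun s => (transl_mem_iff (b s)).2 (hb s)
  obtain ⟨u, hu⟩ := hsurj (fun s => fromBlocks 1 (b s) 0 1) htU
  -- the translation is a symmetry with `τ = id`
  have hγ : ∀ y a, F y (u * a) = F (id y) a := fun y a => hN y u a fun s => ⟨b s, hb s, by rw [hu]⟩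
  have key := descended_cocycle k Φ f hE0 (γ := fun s => fromBlocks 1 (b s) 0 1) htU (τ := id)
    (fun y g hg => by
      have h := tube_symmetry_of_frame Fr hmul hsurj F Φ hΦ hγ y g hg
      rw [hu] at h
      exact h) x hZ
  simp only [moeb_transl, denom_transl, det_one, _root_.one_zpow, Finset.prod_const_one, one_mul, id] at key
  exact key

include hmul hmem hsurj hΦ hE0 hN in
/-- **RIGIDITY THROUGH A FRAME MAP.**  `A` a group, `Fr : A → ∏_σ M_{2n}(ℂ)` multiplicative, valued in and ONTO `∏_σ U(J)`; `F : X → A → ℂ`,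
`Φ` its tube-side avatar (`Φ x (Fr a) = F x a`), `f` the holomorphic descent of `Φ` ((E0) dictionary with weights `k`, (E1) holomorphy on `ℌ_n^σ`);
`F x` invariant under the framed unipotents; ONE symmetry `aγ ∈ A`, `F x (aγ a) = F (τ x) a`, whose framed cocycle `∏_s det(denom (Fr aγ)_s Z_s)^{k_s}`
is not constant on `ℌ_n^σ`.  Then `F = 0`. (★ core `eq_zero_of_hol_of_transl_invariant`.) [cite: Shimura1997, §§5–6] -/
theorem eq_zero_of_hol_of_frame
    (hhol : ∀ x, DifferentiableOn ℂ (fun z : σ → Fin n → Fin n → ℂ => f x fun s => Matrix.of (z s))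
      {z | ∀ s, Matrix.of (z s) ∈ hermUpperHalfSpace n})
    {aγ : A} {τ : X → X} (hγ : ∀ x a, F x (aγ * a) = F (τ x) a)
    (hJ : ∃ Z W : σ → Matrix (Fin n) (Fin n) ℂ, (∀ s, Z s ∈ hermUpperHalfSpace n) ∧ (∀ s, W s ∈ hermUpperHalfSpace n) ∧
      (∏ s, (denom (Fr aγ s) (Z s)).det ^ k s) ≠ ∏ s, (denom (Fr aγ s) (W s)).det ^ k s)
    (x : X) (a : A) : F x a = 0 := by
  have h := eq_zero_of_hol_of_transl_invariant k Φ f hE0 hhol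
    (fun y Z b hZ hb => apply_add_eq_of_unip_invariant Fr hmul hsurj k F Φ hΦ f hE0 hN y Z b hZ hb) (γ := Fr aγ) (hmem aγ) (τ := τ)
    (fun y g hg => tube_symmetry_of_frame Fr hmul hsurj F Φ hΦ hγ y g hg) hJ x (g := Fr a) (hmem a)
  rwa [hΦ] at h

end Frame

/-! ## 2. The adelic frame map: `A = H_∞`, `σ` = complex places, `Fr_w(a) = T_w · (a_w)~ · T_w⁻¹` -/

section Adelic

variable (L : Type) [Field L] [NumberField L] [IsCMField L] {N M n : ℕ} (e : Fin N × Fin M ≃ Fin n)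
  (dV : Fin N → L) (hdV : ∀ i, IsCMField.complexConj L (dV i) = dV i)
  (dW : Fin M → L) (hdW : ∀ i, IsCMField.complexConj L (dW i) = dW i)
  (T Tinv : {w : InfinitePlace L // w.IsComplex} → Matrix (Fin n ⊕ Fin n) (Fin n ⊕ Fin n) ℂ)
  (Fr : UnitaryGroup.arch (Fp L) L (IsCMField.complexConj L) (n + n) (hermD L e dV hdV dW hdW) →
    {w : InfinitePlace L // w.IsComplex} → Matrix (Fin n ⊕ Fin n) (Fin n ⊕ Fin n) ℂ)
  (hFr : ∀ a w, Fr a w = T w * Matrix.reindex (e₂ (n := n)).symm (e₂ (n := n)).symm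
    (((UnitaryGroup.archAt (Fp L) L (IsCMField.complexConj L) (n + n) (hermD L e dV hdV dW hdW) w
      (UnitaryGroup.complexConj_smul_infinitePlace L w.1) (IsCMField.complexConj_ne_one L) a :
        UnitaryGroup.archLocal L (n + n) (hermD L e dV hdV dW hdW) w) : GL (Fin (n + n)) ℂ) : Matrix (Fin (n + n)) (Fin (n + n)) ℂ) * Tinv w)
  (hT2 : ∀ w, Tinv w * T w = 1)
  (hTU : ∀ w (g : GL (Fin (n + n)) ℂ), g ∈ UnitaryGroup.archLocal L (n + n) (hermD L e dV hdV dW hdW) w →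
    (T w * Matrix.reindex (e₂ (n := n)).symm (e₂ (n := n)).symm (g : Matrix _ _ ℂ) * Tinv w)ᴴ * Matrix.J (Fin n) ℂ *
      (T w * Matrix.reindex (e₂ (n := n)).symm (e₂ (n := n)).symm (g : Matrix _ _ ℂ) * Tinv w) = Matrix.J (Fin n) ℂ)
  (hTN : ∀ w (b : Matrix (Fin n) (Fin n) ℂ), bᴴ = b → ∃ u : GL (Fin (n + n)) ℂ,
    u ∈ UnitaryGroup.archLocal L (n + n) (hermD L e dV hdV dW hdW) w ∧ IsUnipM (n := n) (u : Matrix (Fin (n + n)) (Fin (n + n)) ℂ) ∧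
      T w * Matrix.reindex (e₂ (n := n)).symm (e₂ (n := n)).symm (u : Matrix _ _ ℂ) * Tinv w = fromBlocks 1 b 0 1)
  (hTS : ∀ w (P : Matrix (Fin n ⊕ Fin n) (Fin n ⊕ Fin n) ℂ), Pᴴ * Matrix.J (Fin n) ℂ * P = Matrix.J (Fin n) ℂ →
    ∃ g : GL (Fin (n + n)) ℂ, g ∈ UnitaryGroup.archLocal L (n + n) (hermD L e dV hdV dW hdW) w ∧
      T w * Matrix.reindex (e₂ (n := n)).symm (e₂ (n := n)).symm (g : Matrix _ _ ℂ) * Tinv w = P)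


omit [NumberField L] in
/-- Conjugation by the frame is injective: `T X T⁻¹ = T Y T⁻¹ → X = Y`. [folklore] -/
theorem eq_of_frame_conj_eq {w : {w : InfinitePlace L // w.IsComplex}} (hT2 : Tinv w * T w = 1)
    {X Y : Matrix (Fin n ⊕ Fin n) (Fin n ⊕ Fin n) ℂ} (h : T w * X * Tinv w = T w * Y * Tinv w) : X = Y := by
  have key : ∀ Z : Matrix (Fin n ⊕ Fin n) (Fin n ⊕ Fin n) ℂ, Tinv w * (T w * Z * Tinv w) * T w = Z := fun Z => by
    rw [show Tinv w * (T w * Z * Tinv w) * T w = (Tinv w * T w) * Z * (Tinv w * T w) by simp only [Matrix.mul_assoc], hT2,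
      Matrix.one_mul, Matrix.mul_one]
  rw [← key X, ← key Y, h]

include hFr hT2 in
/-- **`Fr` is multiplicative**: `Fr (a b) w = Fr a w · Fr b w` (`archAt w` is a homomorphism, `T⁻¹ T = 1`). [cite: BorelJacquet1979, §4.1] -/
theorem frame_mul (a b : UnitaryGroup.arch (Fp L) L (IsCMField.complexConj L) (n + n) (hermD L e dV hdV dW hdW))
    (w : {w : InfinitePlace L // w.IsComplex}) : Fr (a * b) w = Fr a w * Fr b w := by
  set X : Matrix (Fin (n + n)) (Fin (n + n)) ℂ := (((UnitaryGroup.archAt (Fp L) L (IsCMField.complexConj L) (n + n) (hermD L e dV hdV dW hdW) w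
      (UnitaryGroup.complexConj_smul_infinitePlace L w.1) (IsCMField.complexConj_ne_one L) a :
        UnitaryGroup.archLocal L (n + n) (hermD L e dV hdV dW hdW) w) : GL (Fin (n + n)) ℂ) : Matrix (Fin (n + n)) (Fin (n + n)) ℂ) with hX
  set Y : Matrix (Fin (n + n)) (Fin (n + n)) ℂ := (((UnitaryGroup.archAt (Fp L) L (IsCMField.complexConj L) (n + n) (hermD L e dV hdV dW hdW) w
      (UnitaryGroup.complexConj_smul_infinitePlace L w.1) (IsCMField.complexConj_ne_one L) b :
        UnitaryGroup.archLocal L (n + n) (hermD L e dV hdV dW hdW) w) : GL (Fin (n + n)) ℂ) : Matrix (Fin (n + n)) (Fin (n + n)) ℂ) with hY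
  have hXY : (((UnitaryGroup.archAt (Fp L) L (IsCMField.complexConj L) (n + n) (hermD L e dV hdV dW hdW) w
      (UnitaryGroup.complexConj_smul_infinitePlace L w.1) (IsCMField.complexConj_ne_one L) (a * b) :
        UnitaryGroup.archLocal L (n + n) (hermD L e dV hdV dW hdW) w) : GL (Fin (n + n)) ℂ) : Matrix (Fin (n + n)) (Fin (n + n)) ℂ) = X * Y := by
    rw [map_mul, Subgroup.coe_mul, Units.val_mul]
  have hre : Matrix.reindex (e₂ (n := n)).symm (e₂ (n := n)).symm (X * Y) =
      Matrix.reindex (e₂ (n := n)).symm (e₂ (n := n)).symm X * Matrix.reindex (e₂ (n := n)).symm (e₂ (n := n)).symm Y := by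
    rw [Matrix.reindex_apply, Matrix.reindex_apply, Matrix.reindex_apply]
    exact (Matrix.submatrix_mul_equiv X Y _ (e₂ (n := n)).symm.symm _).symm
  rw [hFr, hFr, hFr, hXY, hre]
  rw [show T w * Matrix.reindex (e₂ (n := n)).symm (e₂ (n := n)).symm X * Tinv w * (T w * Matrix.reindex (e₂ (n := n)).symm (e₂ (n := n)).symm Y * Tinv w) =
    T w * Matrix.reindex (e₂ (n := n)).symm (e₂ (n := n)).symm X * (Tinv w * T w) * Matrix.reindex (e₂ (n := n)).symm (e₂ (n := n)).symm Y * Tinv w by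
      simp only [Matrix.mul_assoc], hT2, Matrix.mul_one]
  simp only [Matrix.mul_assoc]

include hFr hTU in
/-- **`Fr` lands in the tube group `{Pᴴ J P = J}`** (clause (iii)). [cite: Shimura1997, §5] -/
theorem frame_mem (a : UnitaryGroup.arch (Fp L) L (IsCMField.complexConj L) (n + n) (hermD L e dV hdV dW hdW))
    (w : {w : InfinitePlace L // w.IsComplex}) : (Fr a w)ᴴ * Matrix.J (Fin n) ℂ * Fr a w = Matrix.J (Fin n) ℂ := by
  rw [hFr]
  exact hTU w _ (UnitaryGroup.archAt (Fp L) L (IsCMField.complexConj L) (n + n) (hermD L e dV hdV dW hdW) w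
    (UnitaryGroup.complexConj_smul_infinitePlace L w.1) (IsCMField.complexConj_ne_one L) a).2

include hFr hTS in
/-- **`Fr` is ONTO `∏_w {Pᴴ J P = J}`** (clause (vi) place by place, glued by ★ `archPiEquiv`). [cite: BorelJacquet1979, §4.1] -/
theorem frame_surj (g : {w : InfinitePlace L // w.IsComplex} → Matrix (Fin n ⊕ Fin n) (Fin n ⊕ Fin n) ℂ)
    (hg : ∀ w, (g w)ᴴ * Matrix.J (Fin n) ℂ * g w = Matrix.J (Fin n) ℂ) :
    ∃ a : UnitaryGroup.arch (Fp L) L (IsCMField.complexConj L) (n + n) (hermD L e dV hdV dW hdW), Fr a = g := by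
  choose gw hgw hTg using fun w => hTS w (g w) (hg w)
  refine ⟨(UnitaryGroup.archPiEquiv (Fp L) L (IsCMField.complexConj L) (n + n) (hermD L e dV hdV dW hdW) (IsCMField.complexConj_ne_one L)
    (UnitaryGroup.complexConj_smul_infinitePlace L)).symm (fun w => ⟨gw w, hgw w⟩), funext fun w => ?_⟩
  rw [hFr, UnitaryGroup.archAt_archPiEquiv_symm]
  exact hTg w

include hFr hT2 hTN in
/-- **`Fr` detects `N_Δ`**: if every `Fr u w` is a hermitian translation then `(u, 1) ∈ N_Δ(𝔸)` (clause (iv′), frame injectivity, ★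
`mem_unipDeltaArch_iff_forall_archAt`). [cite: BorelJacquet1979, §4.1] [cite: MoeglinWaldspurger1995, I.2.1] -/
theorem archToAdelic_mem_unipDelta_of_frame {u : UnitaryGroup.arch (Fp L) L (IsCMField.complexConj L) (n + n) (hermD L e dV hdV dW hdW)}
    (hu : ∀ w, ∃ b : Matrix (Fin n) (Fin n) ℂ, bᴴ = b ∧ Fr u w = fromBlocks 1 b 0 1) :
    (UnitaryGroup.archToAdelic (Fp L) L (IsCMField.complexConj L) (n + n) (hermD L e dV hdV dW hdW) u : HA L e dV hdV dW hdW) ∈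
      unipDelta L e dV hdV dW hdW := by
  rw [← mem_unipDeltaArch_iff, mem_unipDeltaArch_iff_forall_archAt]
  intro w
  obtain ⟨b, hb, hub⟩ := hu w
  obtain ⟨u', _, hU', hTu'⟩ := hTN w b hb
  rw [hFr, ← hTu'] at hub
  have h := (Matrix.reindex (e₂ (n := n)).symm (e₂ (n := n)).symm).injective (eq_of_frame_conj_eq L T Tinv (hT2 w) hub)
  rw [h]
  exact hU'

include hFr in
/-- **The frame image of the Weyl element**: `Fr (w_Δ)_∞ w = T_w · diag(1, −1) · T_w⁻¹` (★ `weylDelta_mem_ratH`, ★ `coe_weylDelta_eq_map`,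
`(γ)_∞ = γ ⊗ 1`, `σ_w(diag(1,−1)) = diag(1,−1)`). [cite: GelbartPiatetskishapiroRallis1987, Part A §1] [cite: BorelJacquet1979, §4.1] -/
theorem frame_archPart_weylDelta (w : {w : InfinitePlace L // w.IsComplex}) :
    Fr (UnitaryGroup.archPart (Fp L) L (IsCMField.complexConj L) (n + n) (hermD L e dV hdV dW hdW) (weylDelta L e dV hdV dW hdW)) w =
      T w * fromBlocks 1 0 0 (-1) * Tinv w := by
  obtain ⟨γ, hγ⟩ := weylDelta_mem_ratH L e dV hdV dW hdW
  -- the rational matrix of `γ` is `e₂ · diag(1, −1) · e₂⁻¹`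
  have hmat : ((γ : GL (Fin (n + n)) L) : Matrix (Fin (n + n)) (Fin (n + n)) L) =
      Matrix.reindex (e₂ (n := n)) (e₂ (n := n)) (fromBlocks (1 : Matrix (Fin n) (Fin n) L) 0 0 (-1)) := by
    have h1 : (((UnitaryGroup.toAdelic (Fp L) L (IsCMField.complexConj L) (n + n) (hermD L e dV hdV dW hdW) γ : HA L e dV hdV dW hdW) :
        GL (Fin (n + n)) (AdeleRing (𝓞 L) L)) : Matrix (Fin (n + n)) (Fin (n + n)) (AdeleRing (𝓞 L) L)) =
        ((γ : GL (Fin (n + n)) L) : Matrix (Fin (n + n)) (Fin (n + n)) L).map (algebraMap L (AdeleRing (𝓞 L) L)) := rfl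
    have h2 := coe_weylDelta_eq_map L e dV hdV dW hdW
    have h3 : ((UnitaryGroup.toAdelic (Fp L) L (IsCMField.complexConj L) (n + n) (hermD L e dV hdV dW hdW) γ : HA L e dV hdV dW hdW) :
        GL (Fin (n + n)) (AdeleRing (𝓞 L) L)) = ((weylDelta L e dV hdV dW hdW : HA L e dV hdV dW hdW) : GL (Fin (n + n)) (AdeleRing (𝓞 L) L)) := by
      rw [hγ]
    rw [← h3, h1] at h2
    exact (Matrix.map_injective (AdeleRing.algebraMap_injective (𝓞 L) L)) h2
  have harch : UnitaryGroup.archPart (Fp L) L (IsCMField.complexConj L) (n + n) (hermD L e dV hdV dW hdW) (weylDelta L e dV hdV dW hdW) =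
      UnitaryGroup.rationalToArch (Fp L) L (IsCMField.complexConj L) (n + n) (hermD L e dV hdV dW hdW) γ := by
    rw [← hγ]
    exact UnitaryGroup.archPart_toAdelic' (Fp L) L (IsCMField.complexConj L) (n + n) (hermD L e dV hdV dW hdW) γ
  rw [hFr, harch, UnitaryGroup.archAt_rationalToArch, UnitaryGroup.coe_rationalToArchLocal]
  have hval : ((Matrix.GeneralLinearGroup.map (w.1.embedding) (γ : GL (Fin (n + n)) L) : GL (Fin (n + n)) ℂ) :
      Matrix (Fin (n + n)) (Fin (n + n)) ℂ) = ((γ : GL (Fin (n + n)) L) : Matrix (Fin (n + n)) (Fin (n + n)) L).map w.1.embedding := rfl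
  have hmapW : (Matrix.reindex (e₂ (n := n)) (e₂ (n := n)) (fromBlocks (1 : Matrix (Fin n) (Fin n) L) 0 0 (-1))).map w.1.embedding =
      Matrix.reindex (e₂ (n := n)) (e₂ (n := n)) (fromBlocks (1 : Matrix (Fin n) (Fin n) ℂ) 0 0 (-1)) := by
    rw [Matrix.reindex_apply, Matrix.reindex_apply, ← Matrix.submatrix_map, Matrix.fromBlocks_map,
      Matrix.map_one _ (map_zero _) (map_one _), Matrix.map_zero _ (map_zero _), Matrix.map_neg _ (map_neg _),
      Matrix.map_one _ (map_zero _) (map_one _)]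
  rw [hval, hmat, hmapW, Matrix.reindex_apply, Matrix.reindex_apply, Matrix.submatrix_submatrix, Equiv.symm_symm, Equiv.symm_comp_self,
    Matrix.submatrix_id_id]

end Adelic

end Summit.HodgeConjecture.HodgeConjecture.Cruxes.HLiu418.K2LiuHolTubeRigidityOfFrame

end
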